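import Summits.MatrixMultiplication.OmegaCensus.STPPAlignedDoubleKneserFilter

/-!
# ω-census (abelian STPP census): the N18 chain WITH its Kneser stabilisers — the kernel half of the 'Kneser-coset' reduction (kernel)

HONEST FRAMING (pub-omega census; verbatim): lottery ticket; floor = certified bounds/negative ranges.
Census STRUCTURE (seat pub-omega-stpp-2 gen 24, 2026-08-28), family (b2); OMEGA-TABLE NR262 (Kneser-coset law idea + pilot).  A necessary condition on STPP
families in a finite abelian group — a tool for EXCLUDING candidate block patterns; nothing here is progress on `ω`.

## Statement

Setting of `STPPAlignedDoubleKneserFilter.lean` (N18, `C`-reading): STPP family `(A_k, B_k, C_k)` with non-empty sets in a finite abelian `H`, block `i`, another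
block present; `S := −Aᵢ`, `Y° := ⋃_{k≠i}(C_k − B_k)` (`|Y°| = L`), `Z° := ⋃_{k≠i}(C_k − A_k)` (`|Z°| = z`), `W := Cᵢ − Aᵢ − Bᵢ` (`|W| = vol`), `S₁ := S + Y°`,
`V := W ⊔ S₁`, `S₂ := Bᵢ + V ⊆ H ∖ Z°`.  N18 (`exists_dvd_dvd_alignedKneser_AB`) records only the ORDERS of the Kneser stabilisers; this file keeps the stabilisers
themselves: with `K₁ := Stab(S₁)` and `K₂ := Stab(S₂)` (the tree's `Finset.addStab`),

* `kneserLB(|Aᵢ|, L, |K₁|) ≤ |S₁|`,  `S₁ + K₁ = S₁`,  `|K₁| ∣ |S₁|`,  `|K₁| ∣ |H|`;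
* `|V| = vol + |S₁|`,  `kneserLB(|Bᵢ|, |V|, |K₂|) ≤ |S₂|`,  `S₂ + K₂ = S₂`,  `|K₂| ∣ |S₂|`,  `|K₂| ∣ |H|`;
* `S₂` is disjoint from `Z°`, so `|S₂| + z ≤ |H|`, and every `K₂`-translate of a point of `Z°` stays outside `S₂` (`Z° + K₂ ⊆ H ∖ S₂`)

(`n18_chain_addStab`).  CONSEQUENCE used by the pilot (`sub_mem_compl_of_mem_DU_AC`, `subset_sub_image_of_diff_subset`): if a difference set `C′ − A′` lies in
a set `T` then `A′ ⊆ c − T` for every `c ∈ C′` and `C′ ⊆ a + T` for every `a ∈ A′` — with `T = H ∖ S₂` a union of `(|H| − |S₂|)/|K₂|` cosets of `K₂`, this is the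
'coset confinement' of the blocks `k ≠ i`.  Everything is elementary on top of the tree's Kneser theorem (`Literature.Combinatorics.Additive.add_kneser` via
`STPPKneser.exists_dvd_kneserLB_le_card_add`'s proof pattern).  The companion pilot (HOME PILOT-coset.md) uses exactly these facts as the WLOG for its
restricted searches; its UNSAT verdicts are engine facts, not theorems of this file.

References: M. Kneser, Math. Z. 58 (1953) (tree: `add_kneser`, `Finset.addStab`); T. Tao, V. Vu, *Additive Combinatorics*, Thm 5.5; H. Cohn, R. Kleinberg,
B. Szegedy, C. Umans, FOCS 2005 (arXiv:math/0511460), Def. 5.1.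
-/

open Finset
open scoped Pointwise

namespace Summit.MatrixMultiplication.OmegaCensus.CubeNB

open Literature.Computability.AlgebraicComplexity
open Summit.MatrixMultiplication.OmegaCensus.STPPKneser

section Stab

variable {G : Type*} [AddCommGroup G] [DecidableEq G] [Fintype G]

/-- **Kneser's theorem with the stabiliser kept.**  For non-empty `S, T` in a finite abelian group, with `K = Stab(S + T)`:
`kneserLB(|S|, |T|, |K|) ≤ |S + T|`, `(S + T) + K = S + T`, `0 < |K|`, `|K| ∣ |G|`, `|K| ∣ |S + T|`.  (The census form
`exists_dvd_kneserLB_le_card_add` forgets `K`; same proof.) [cite: Kneser1953] [cite: TaoVu2006, Thm 5.5] -/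
theorem kneserLB_addStab_le_card_add (S T : Finset G) (hS : S.Nonempty) (hT : T.Nonempty) :
    kneserLB (#S) (#T) (#((S + T).addStab)) ≤ #(S + T) ∧ (S + T) + (S + T).addStab = S + T ∧
      0 < #((S + T).addStab) ∧ #((S + T).addStab) ∣ Fintype.card G ∧ #((S + T).addStab) ∣ #(S + T) := by
  have hkn := Literature.Combinatorics.Additive.add_kneser S T
  set K := (S + T).addStab with hK
  have hKne : K.Nonempty := (hS.add hT).addStab
  refine ⟨?_, Finset.add_addStab (S + T), hKne.card_pos, (hS.add hT).card_addStab_dvd_card_univ, Finset.card_addStab_dvd_card (S + T)⟩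
  have h1 : (#S + #K - 1) / #K * #K ≤ #(S + K) :=
    ceilDiv_mul_le_of_dvd hKne.card_pos (Finset.card_addStab_dvd_card_add_addStab S (S + T)) (card_le_card_add_right hKne)
  have h2 : (#T + #K - 1) / #K * #K ≤ #(T + K) :=
    ceilDiv_mul_le_of_dvd hKne.card_pos (Finset.card_addStab_dvd_card_add_addStab T (S + T)) (card_le_card_add_right hKne)
  unfold kneserLB
  have : ((#S + #K - 1) / #K + (#T + #K - 1) / #K - 1) * #K =
      (#S + #K - 1) / #K * #K + (#T + #K - 1) / #K * #K - #K := by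
    rw [Nat.sub_mul, Nat.add_mul, one_mul]
  rw [this]
  omega

omit [Fintype G] in
/-- A stabiliser is closed under negation: `k ∈ Stab(X)` ⇒ `−k ∈ Stab(X)` (local copy; the tree's `CubeNB.neg_mem_addStab` in
`STPP222DensityTen.lean` carries a heavier import chain). [cite: Kneser1953] -/
private theorem neg_mem_addStab_local {X : Finset G} {k : G} (hk : k ∈ X.addStab) : -k ∈ X.addStab := by
  have hX : X.Nonempty := Finset.Nonempty.of_addStab ⟨k, hk⟩
  rw [Finset.mem_addStab' hX] at hk ⊢
  intro b hb
  -- the translation by `k` is a bijection of `X`, so `b` has a preimage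
  have hsurj : (X.image fun x => k +ᵥ x) = X := by
    apply Finset.eq_of_subset_of_card_le
    · intro y hy
      obtain ⟨x, hx, rfl⟩ := Finset.mem_image.1 hy
      exact hk hx
    · rw [Finset.card_image_of_injective _ (fun x y h => by simpa using h)]
  obtain ⟨x, hx, hxb⟩ := Finset.mem_image.1 (hsurj.symm ▸ hb)
  have : -k +ᵥ b = x := by rw [← hxb, vadd_eq_add, vadd_eq_add]; abel
  rw [this]; exact hx

omit [Fintype G] in
/-- If `X + K = X` for the stabiliser `K = Stab(X)`, a point outside `X` stays outside under every `K`-translate. [cite: Kneser1953] -/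
theorem add_notMem_of_notMem_of_mem_addStab {X : Finset G} {x k : G} (hx : x ∉ X) (hk : k ∈ X.addStab) : x + k ∉ X := by
  intro h
  have hX : X.Nonempty := ⟨_, h⟩
  have hneg := (Finset.mem_addStab' hX).1 (neg_mem_addStab_local hk) h
  have : -k +ᵥ (x + k) = x := by rw [vadd_eq_add]; abel
  rw [this] at hneg
  exact hx hneg

omit [Fintype G] in
/-- Confinement from a difference-set inclusion: if `c − a ∈ T` for all `a ∈ A′`, `c ∈ C′`, then `A′ ⊆ c₀ − T` for each `c₀ ∈ C′`. [folklore] -/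
theorem subset_image_sub_of_diff_subset {A' C' T : Finset G} (h : ∀ a ∈ A', ∀ c ∈ C', c - a ∈ T) {c₀ : G} (hc₀ : c₀ ∈ C') :
    A' ⊆ T.image (fun t => c₀ - t) := by
  intro a ha
  exact Finset.mem_image.2 ⟨c₀ - a, h a ha c₀ hc₀, by abel⟩

omit [Fintype G] in
/-- Confinement, the other side: `C′ ⊆ a₀ + T` for each `a₀ ∈ A′`. [folklore] -/
theorem subset_image_add_of_diff_subset {A' C' T : Finset G} (h : ∀ a ∈ A', ∀ c ∈ C', c - a ∈ T) {a₀ : G} (ha₀ : a₀ ∈ A') :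
    C' ⊆ T.image (fun t => a₀ + t) := by
  intro c hc
  exact Finset.mem_image.2 ⟨c - a₀, h a₀ ha₀ c hc, by abel⟩

end Stab

section Chain

variable {H : Type*} [AddCommGroup H] [DecidableEq H] [Fintype H] {N : ℕ} {A B C : Fin N → Finset H}

/-- **N18 with its stabilisers** (`C`-reading).  See the module docstring: the two Kneser steps of the N18 chain with `K₁ = Stab(S₁)`, `K₂ = Stab(S₂)` kept,
the size of `V`, the disjointness `S₂ ∩ Z° = ∅`, and `|S₂| + |Z°| ≤ |H|`. [cite: Kneser1953] [cite: CohnKleinbergSzegedyUmans2005, Def. 5.1] -/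
theorem n18_chain_addStab (hS : IsSTPP A B C) (hA : ∀ i, (A i).Nonempty) (hB : ∀ i, (B i).Nonempty)
    (hC : ∀ i, (C i).Nonempty) (i : Fin N) (hI : (univ.erase i : Finset (Fin N)).Nonempty) :
    let W := ((A i) ×ˢ ((B i) ×ˢ (C i))).image fun q : H × H × H => (0 : H) + q.2.2 - q.1 - q.2.1
    let S₁ := (A i).image (fun a => (0 : H) - a) + DU B C (univ.erase i)
    let S₂ := B i + (W ∪ S₁)
    kneserLB #(A i) (∑ k ∈ univ.erase i, #(B k) * #(C k)) #(S₁.addStab) ≤ #S₁ ∧ S₁ + S₁.addStab = S₁ ∧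
      0 < #(S₁.addStab) ∧ #(S₁.addStab) ∣ Fintype.card H ∧ #(S₁.addStab) ∣ #S₁ ∧
    #(W ∪ S₁) = #(A i) * #(B i) * #(C i) + #S₁ ∧
    kneserLB #(B i) (#(A i) * #(B i) * #(C i) + #S₁) #(S₂.addStab) ≤ #S₂ ∧ S₂ + S₂.addStab = S₂ ∧
      0 < #(S₂.addStab) ∧ #(S₂.addStab) ∣ Fintype.card H ∧ #(S₂.addStab) ∣ #S₂ ∧
    Disjoint S₂ (DU A C (univ.erase i)) ∧ #(DU A C (univ.erase i)) = ∑ k ∈ univ.erase i, #(A k) * #(C k) ∧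
    #S₂ + ∑ k ∈ univ.erase i, #(A k) * #(C k) ≤ Fintype.card H := by
  intro W S₁ S₂
  have hWcard : #W = #(A i) * #(B i) * #(C i) := card_image_blockSum hS i 0
  have hScard : #((A i).image (fun a => (0 : H) - a)) = #(A i) := Finset.card_image_of_injective _ (sub_right_injective)
  have hYcard : #(DU B C (univ.erase i)) = ∑ k ∈ univ.erase i, #(B k) * #(C k) := card_DU_BC hS hA _
  have hZcard : #(DU A C (univ.erase i)) = ∑ k ∈ univ.erase i, #(A k) * #(C k) := card_DU_AC hS hB _
  have hSne : ((A i).image (fun a => (0 : H) - a)).Nonempty := (hA i).image _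
  have hYne : (DU B C (univ.erase i)).Nonempty := DU_nonempty hI hB hC
  -- first Kneser
  obtain ⟨hk1, hper1, hpos1, hdvd1, hdvd1'⟩ := kneserLB_addStab_le_card_add _ _ hSne hYne
  rw [hScard, hYcard] at hk1
  -- V = W ⊔ S₁
  have hWV : Disjoint W S₁ := disjoint_W_negA_add_DU hS i
  have hVcard : #(W ∪ S₁) = #(A i) * #(B i) * #(C i) + #S₁ := by rw [Finset.card_union_of_disjoint hWV, hWcard]
  have hVne : (W ∪ S₁).Nonempty := (hSne.add hYne).mono Finset.subset_union_right
  -- second Kneser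
  obtain ⟨hk2, hper2, hpos2, hdvd2, hdvd2'⟩ := kneserLB_addStab_le_card_add (B i) (W ∪ S₁) (hB i) hVne
  rw [hVcard] at hk2
  -- the inclusion S₂ ⊆ H ∖ Z°
  have hsub := B_add_W_union_negA_add_subset hS i
  have hdisj : Disjoint S₂ (DU A C (univ.erase i)) := by
    rw [Finset.disjoint_left]
    intro w hw hwZ
    have := hsub hw
    rw [Finset.mem_sdiff] at this
    exact this.2 hwZ
  have hle : #S₂ + #(DU A C (univ.erase i)) ≤ Fintype.card H := by
    rw [← Finset.card_union_of_disjoint hdisj]; exact Finset.card_le_univ _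
  rw [hZcard] at hle
  exact ⟨hk1, hper1, hpos1, hdvd1, hdvd1', hVcard, hk2, hper2, hpos2, hdvd2, hdvd2', hdisj, hZcard, hle⟩

/-- **Coset confinement of `Z°`.**  In the N18 setting, `Z° + Stab(S₂)` stays inside `H ∖ S₂`: every block `k ≠ i` has `(C_k − A_k) + Stab(S₂) ⊆ H ∖ S₂`, a set of
`|H| − |S₂|` elements which is a union of cosets of `Stab(S₂)`. [cite: Kneser1953] [cite: CohnKleinbergSzegedyUmans2005, Def. 5.1] -/
theorem DU_AC_add_addStab_subset_compl (hS : IsSTPP A B C) (i : Fin N) :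
    let W := ((A i) ×ˢ ((B i) ×ˢ (C i))).image fun q : H × H × H => (0 : H) + q.2.2 - q.1 - q.2.1
    let S₁ := (A i).image (fun a => (0 : H) - a) + DU B C (univ.erase i)
    let S₂ := B i + (W ∪ S₁)
    DU A C (univ.erase i) + S₂.addStab ⊆ univ \ S₂ := by
  intro W S₁ S₂ w hw
  obtain ⟨zz, hz, k, hk, rfl⟩ := Finset.mem_add.1 hw
  rw [Finset.mem_sdiff]
  refine ⟨Finset.mem_univ _, add_notMem_of_notMem_of_mem_addStab ?_ hk⟩
  intro hzS
  have h' : zz ∈ univ \ DU A C (univ.erase i) := B_add_W_union_negA_add_subset hS i hzS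
  rw [Finset.mem_sdiff] at h'
  exact h'.2 hz

end Chain

section ChainY

variable {H : Type*} [AddCommGroup H] [DecidableEq H] [Fintype H] {N : ℕ} {A B C : Fin N → Finset H}

omit [Fintype H] in
/-- **Coset confinement of `Y°`** (the other side of the reduction).  In the N18 setting, for every `a ∈ Aᵢ` the translate `−a + Y°` together with all its
`Stab(S₁)`-translates lies inside `S₁ = (−Aᵢ) + Y°`: `(−a + Y°) + Stab(S₁) ⊆ S₁`, a union of `|S₁| / |Stab(S₁)|` cosets.
[cite: Kneser1953] [cite: CohnKleinbergSzegedyUmans2005, Def. 5.1] -/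
theorem vadd_DU_BC_add_addStab_subset (i : Fin N) {a : H} (ha : a ∈ A i) :
    let S₁ := (A i).image (fun a => (0 : H) - a) + DU B C (univ.erase i)
    (-a +ᵥ DU B C (univ.erase i)) + S₁.addStab ⊆ S₁ := by
  intro S₁ w hw
  obtain ⟨x, hx, k, hk, rfl⟩ := Finset.mem_add.1 hw
  obtain ⟨y, hy, rfl⟩ := Finset.mem_vadd_finset.1 hx
  have hxS : -a +ᵥ y ∈ S₁ := by
    refine Finset.mem_add.2 ⟨0 - a, Finset.mem_image.2 ⟨a, ha, rfl⟩, y, hy, ?_⟩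
    rw [vadd_eq_add]; abel
  have hS : S₁.Nonempty := ⟨_, hxS⟩
  have := (Finset.mem_addStab' hS).1 hk hxS
  rwa [vadd_eq_add, add_comm] at this

end ChainY

end Summit.MatrixMultiplication.OmegaCensus.CubeNB
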